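import Summits.QuantumFields.BalabanUV.T4Continuum.Support.VectorGaugeCovarianceEffective

/-!
# T⁴ programme, spine node NE2 (U1a), lane P2 — «V-GAUGE-COV», file 7: THE RATE CURRENCY TRANSFERS TOO — `TowerLimitRate 1 1 (k ↦ X^V_k) C ρ` is a statement about
# the gauge ORBIT (model level, `E = ℂ`; cell `pub-balaban`)

NE2 formalisation swarm `b2b-balaban-t4-ne2-formalise-*`, leaf prover 03 GEN 7 (`prover-b2b-balaban-t4-ne2-formalise-leaf-03-g7-0`); register row
«P2-sup» of `t4/formal/NE2/LEAVES.md`; journal INTENT «V-GAUGE-COV» CLAIMS.log l.19543 ∕ l.20133.  On top of file 4 (`VectorGaugeCovarianceEffective.effV_gauge`,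
`phaseM_conjTranspose_mul`, `phaseM_mul_conjTranspose`) and the spine's `CovariantAveragingTower.{Atow, avgTow, TowerLimitRate}` BY NAME.
 * §1 on a FIXED index with identity averagings: `Atow (fun _ ↦ 1) k = 1`, `avgTow (fun _ ↦ 1) 1 X k = X k`, so `TowerLimitRate (fun _ ↦ 1) 1 X C ρ ↔ ∃ X∞, X_k → X∞ ∧
   ∀ k, ‖X_k − X∞‖ ≤ Cρ^k∕(1−ρ)` (`towerLimitRate_one_iff`); the `ℓ²`-operator norm is unitarily invariant (`norm_conj_unitary_le`, `norm_conj_unitary_eq`);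
   **`towerLimitRate_one_of_conj`**: the rate statement for `k ↦ V X_k Vᴴ` (`V` unitary) implies it for `X`, SAME `C`, SAME `ρ`, limit `Vᴴ X∞ V`.
 * §2 **`towerLimitRate_effV_of_gauge`**: along ANY unitary site fields `u k` (level `k`) and `v` (unit lattice), the RATE conclusion
   `TowerLimitRate (fun _ ↦ 1) 1 (k ↦ effV (L^k) M (R^u k) (U_k Gm_k U_kᴴ) (QmL (T^g k)) a) C ρ` of the vector ENDs with rate (`VariationalVectorTower.towerLimitRate_effV_of_pairs`
   p218948 → `…EndOfLeaves*`, `VariationalColourTaxiTowerEndMin.towerLimitRate_effV_taxiTower_min_of_class`) implies the same statement, same constants, for the PRESENTED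
   tower — the companion of file 5's `effV_limit_of_gauge` (existence currency) for the RATE currency.

HONEST FRAMING (T4-DAG p. 1).  Model level (c5), `E = ℂ`; [folklore] bookkeeping, NO analytic content; gauge EXISTENCE not claimed; no `def`, no `def … : Prop`, no `sorry`;
axioms standard.  The rate half of the vector END with background is OPEN ((SLICE-min) ∕ the lower bracket: leaf-10-g4's «V-AVG-G»); V-END ∕ NE2 NOT proved; NE3 OPEN;
spine PROVED 0∕9 unchanged; rung (B)+1 on a fixed finite T⁴ — NOT infinite volume, NOT mass gap, NOT Clay.  HONEST DEPENDENCY (cell, verbatim): continuum YM on T⁴ ⇐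
BetaPertH ∧ nine spine estimates (0/9 proved); BetaPertH ⇐ (D1) ∧ (D4) ∧ CAP+tail; G-an2-4 gates asym, D1 and NE2/3/4.
-/

noncomputable section

namespace Summit.QuantumFields.BalabanUV.T4Continuum.VectorGaugeCovariance

open Finset Matrix Filter
open scoped BigOperators Matrix Matrix.Norms.L2Operator ComplexConjugate ComplexOrder Topology
open Literature.MathematicalPhysics.QuantumFieldTheory.Balaban1983to89.B5Prop11Plancherel (Tor fine unitVec)
open Summit.QuantumFields.BalabanUV.T4Continuum.CovariantAveragingTower (Atow avgTow TowerLimitRate opNorm_one_le)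
open Summit.QuantumFields.BalabanUV.T4Continuum.VariationalVectorEffective (effV)
open Summit.QuantumFields.BalabanUV.T4Continuum.VariationalVectorTower (QmL)

variable {d : ℕ}

/-! ## §1 Identity averagings on a fixed index; unitary invariance of the operator norm -/

section Fixed

variable {κ : Type*} [Fintype κ] [DecidableEq κ]

/-- `Atow (fun _ ↦ 1) k = 1`. [folklore] -/
theorem Atow_one : ∀ k : ℕ, Atow (ι := fun _ => κ) (fun _ => (1 : Matrix κ κ ℂ)) k = 1
  | 0 => rfl
  | k + 1 => by rw [CovariantAveragingTower.Atow_succ, Atow_one k, Matrix.mul_one]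

/-- `avgTow (fun _ ↦ 1) 1 X k = X k`. [folklore] -/
theorem avgTow_one (X : ℕ → Matrix κ κ ℂ) (k : ℕ) : avgTow (ι := fun _ => κ) (fun _ => (1 : Matrix κ κ ℂ)) 1 X k = X k := by
  unfold avgTow
  rw [Atow_one, Complex.ofReal_one, one_pow, one_smul, Matrix.one_mul, conjTranspose_one, Matrix.mul_one]

/-- the rate currency on a fixed index, unfolded: `TowerLimitRate (fun _ ↦ 1) 1 X C ρ ↔ ∃ X∞, X_k → X∞ ∧ ∀ k, ‖X_k − X∞‖ ≤ Cρ^k∕(1−ρ)`. [folklore] -/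
theorem towerLimitRate_one_iff (X : ℕ → Matrix κ κ ℂ) (C ρ : ℝ) :
    TowerLimitRate (ι := fun _ => κ) (fun _ => (1 : Matrix κ κ ℂ)) 1 X C ρ
      ↔ ∃ Xlim : Matrix κ κ ℂ, Tendsto X atTop (𝓝 Xlim) ∧ ∀ k, ‖X k - Xlim‖ ≤ C * ρ ^ k / (1 - ρ) := by
  have e : avgTow (ι := fun _ => κ) (fun _ => (1 : Matrix κ κ ℂ)) 1 X = X := funext (avgTow_one X)
  unfold TowerLimitRate
  rw [e]

/-- a unitary matrix has `ℓ²`-operator norm `≤ 1`. [folklore] -/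
theorem norm_le_one_of_conjTranspose_mul {V : Matrix κ κ ℂ} (hV : Vᴴ * V = 1) : ‖V‖ ≤ 1 := by
  have h : ‖V‖ * ‖V‖ ≤ 1 := by
    rw [← Matrix.l2_opNorm_conjTranspose_mul_self, hV]; exact opNorm_one_le (ι := fun _ => κ) 0
  nlinarith [norm_nonneg V]

/-- **the `ℓ²`-operator norm is unitarily invariant** (one direction): `‖V A Vᴴ‖ ≤ ‖A‖` for `Vᴴ V = 1`. [folklore] -/
theorem norm_conj_unitary_le {V : Matrix κ κ ℂ} (hV : Vᴴ * V = 1) (A : Matrix κ κ ℂ) : ‖V * A * Vᴴ‖ ≤ ‖A‖ := by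
  have h1 := norm_le_one_of_conjTranspose_mul hV
  have h2 : ‖Vᴴ‖ ≤ 1 := by rw [Matrix.l2_opNorm_conjTranspose]; exact h1
  calc ‖V * A * Vᴴ‖ ≤ ‖V * A‖ * ‖Vᴴ‖ := Matrix.l2_opNorm_mul _ _
    _ ≤ (‖V‖ * ‖A‖) * ‖Vᴴ‖ := mul_le_mul_of_nonneg_right (Matrix.l2_opNorm_mul _ _) (norm_nonneg _)
    _ ≤ (1 * ‖A‖) * 1 := by gcongr
    _ = ‖A‖ := by ring

/-- `‖Vᴴ A V‖ ≤ ‖A‖` for `V Vᴴ = 1`. [folklore] -/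
theorem norm_conj_unitary_le' {V : Matrix κ κ ℂ} (hV' : V * Vᴴ = 1) (A : Matrix κ κ ℂ) : ‖Vᴴ * A * V‖ ≤ ‖A‖ := by
  have h := norm_conj_unitary_le (V := Vᴴ) (by rwa [conjTranspose_conjTranspose]) A
  rwa [conjTranspose_conjTranspose] at h

/-- **THE RATE CURRENCY TRANSFERS ALONG A UNITARY CONJUGATION**: if `k ↦ V X_k Vᴴ` converges with `‖V X_k Vᴴ − Y∞‖ ≤ Cρ^k∕(1−ρ)` then `X_k → Vᴴ Y∞ V` with the SAME bound. [folklore] -/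
theorem towerLimitRate_one_of_conj {V : Matrix κ κ ℂ} (hV : Vᴴ * V = 1) (hV' : V * Vᴴ = 1) (X : ℕ → Matrix κ κ ℂ) {C ρ : ℝ}
    (h : TowerLimitRate (ι := fun _ => κ) (fun _ => (1 : Matrix κ κ ℂ)) 1 (fun k => V * X k * Vᴴ) C ρ) :
    TowerLimitRate (ι := fun _ => κ) (fun _ => (1 : Matrix κ κ ℂ)) 1 X C ρ := by
  rw [towerLimitRate_one_iff] at h ⊢
  obtain ⟨Y, hT, hrate⟩ := h
  have heq : ∀ k, X k = Vᴴ * (V * X k * Vᴴ) * V := fun k => by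
    simp only [Matrix.mul_assoc]
    rw [hV, Matrix.mul_one, ← Matrix.mul_assoc, hV, Matrix.one_mul]
  refine ⟨Vᴴ * Y * V, ?_, fun k => ?_⟩
  · have hc : Tendsto (fun k => Vᴴ * (V * X k * Vᴴ) * V) atTop (𝓝 (Vᴴ * Y * V)) := (hT.const_mul _).mul_const _
    exact hc.congr fun k => (heq k).symm
  · calc ‖X k - Vᴴ * Y * V‖ = ‖Vᴴ * (V * X k * Vᴴ - Y) * V‖ := by rw [Matrix.mul_sub, Matrix.sub_mul, ← heq k]
      _ ≤ ‖V * X k * Vᴴ - Y‖ := norm_conj_unitary_le' hV' _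
      _ ≤ C * ρ ^ k / (1 - ρ) := hrate k

end Fixed

/-! ## §2 The vector END's rate conclusion along the orbit -/

section Tower

variable (L : ℕ) [NeZero L] (M : Fin d → ℕ) [hM : ∀ μ, NeZero (M μ)]
variable {v : Tor M → (ℂ →L[ℂ] ℂ)} (hv : ∀ y, v y ∈ unitary (ℂ →L[ℂ] ℂ))
variable {u : (k : ℕ) → Tor (fine (L ^ k) M) → (ℂ →L[ℂ] ℂ)} (hu : ∀ k x, u k x ∈ unitary (ℂ →L[ℂ] ℂ))
variable (R : (k : ℕ) → Tor (fine (L ^ k) M) → Fin d → (ℂ →L[ℂ] ℂ))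
variable (Gm : (k : ℕ) → Matrix (Tor (fine (L ^ k) M) × Fin d) (Tor (fine (L ^ k) M) × Fin d) ℂ)
variable (T : (k : ℕ) → Tor M → (Fin d → Fin (L ^ k)) → Fin (L ^ k) → Fin d → (ℂ →L[ℂ] ℂ))
include hv hu

/-- **THE GAUGE-ORBIT TRANSFER OF THE RATE CONCLUSION**: `TowerLimitRate (fun _ ↦ 1) 1 (k ↦ effV (L^k) M (R^u k) (U_k Gm_k U_kᴴ) (QmL (T^g k)) a) C ρ` for the GAUGED tower
implies `TowerLimitRate (fun _ ↦ 1) 1 (k ↦ effV (L^k) M (R k) (Gm k) (QmL (T k)) a) C ρ` for the PRESENTED tower — same `C`, same `ρ` (file 4's `effV_gauge`: the gauged effective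
operators are `V X_k Vᴴ`). [folklore] -/
theorem towerLimitRate_effV_of_gauge {a C ρ : ℝ}
    (h : TowerLimitRate (ι := fun _ => Tor M × Fin d) (fun _ => (1 : Matrix (Tor M × Fin d) (Tor M × Fin d) ℂ)) 1
      (fun k => effV (L ^ k) M (gaugeR (fine (L ^ k) M) (u k) (R k))
        (phaseM (fine (L ^ k) M) (u k) * Gm k * (phaseM (fine (L ^ k) M) (u k))ᴴ) (QmL (L ^ k) M (gaugeL (L ^ k) M v (u k) (T k))) a) C ρ) :
    TowerLimitRate (ι := fun _ => Tor M × Fin d) (fun _ => (1 : Matrix (Tor M × Fin d) (Tor M × Fin d) ℂ)) 1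
      (fun k => effV (L ^ k) M (R k) (Gm k) (QmL (L ^ k) M (T k)) a) C ρ := by
  have e : (fun k => effV (L ^ k) M (gaugeR (fine (L ^ k) M) (u k) (R k))
        (phaseM (fine (L ^ k) M) (u k) * Gm k * (phaseM (fine (L ^ k) M) (u k))ᴴ) (QmL (L ^ k) M (gaugeL (L ^ k) M v (u k) (T k))) a)
      = fun k => phaseM M v * effV (L ^ k) M (R k) (Gm k) (QmL (L ^ k) M (T k)) a * (phaseM M v)ᴴ := funext fun k => effV_gauge (L ^ k) M hv (hu k) (R k) (Gm k) (T k) a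
  rw [e] at h
  exact towerLimitRate_one_of_conj (phaseM_conjTranspose_mul hv) (phaseM_mul_conjTranspose hv) _ h

end Tower

end Summit.QuantumFields.BalabanUV.T4Continuum.VectorGaugeCovariance

end
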